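/-
Copyright: cell pub-balaban-gaps (YM BLITZ Y1, track G1), seat g1-p2 GEN 5 (unit `pub-balaban-gaps-g1-p2`).  Row (D4) NODE O,
OBJECT ∕ MECHANISM level: [B9] (3.87)–(3.94) ∕ Cor 3.8 in the BLOCK currency — the PARAMETRIX JUNCTION: seed `Σ_□ h_□G′_□h_□`
and step `Σ_□ K(h_□)G′_□h_□` BUILT from partition + local inverses + commutators, their (3.89)-shape block letters DERIVED,
(3.88) DISCHARGED by the prior programme's `Beta/UnitLatticeWalkInversion.resummation_identity` (b2b-balaban-beta-d4-p3,
2026-08-20; cited and ported, not rebuilt — g1-plan-1 ROUTES-PLAN-1 §2 note 26 (d)), Thm 3.10 at one scale by `D4WalkBlockOneScale`.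
HONEST FRAMING: mechanism over hypothesis letters; Bałaban's `Δ^{(k)}`, `G′_□`, `h_□` NOT constructed, (3.42) ∕ Cor 3.6 for his
local inverses NOT proved (the input letter `hLbd`); (D4) NOT discharged (instance 0∕1); NOT BetaPertH, NOT continuum, NOT Clay.
-/
import Summits.QuantumFields.BalabanUV.Gaps.D4WalkBlockOneScale
import Summits.QuantumFields.BalabanUV.T4Continuum.Spine.NE5.TwoRunPencilDomains
import Summits.QuantumFields.BalabanUV.Beta.UnitLatticeWalkInversion

/-!
# `Gaps.D4WalkBlockParametrix` — (3.87)–(3.94): the seed ∕ step families BUILT from partition, local inverses and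
commutators; their block letters DERIVED; (3.88) DISCHARGED; Thm 3.10 at one scale from Thm 3.7's inputs
(cell pub-balaban-gaps, seat g1-p2 gen 5)

HONEST DEPENDENCY (cell pub-balaban, verbatim): continuum YM on T⁴ ⇐ BetaPertH ∧ nine spine estimates (0/9 proved);
BetaPertH ⇐ (D1) ∧ (D4) ∧ CAP+tail.

[B9] p. 409: *"consider S = Σ_□ h_□G′_□h_□.  We have Δ′S = Σ_□ h_□² + Σ_□ K(h_□)G′_□h_□ = I − R"* ((3.87)–(3.88)),
*"|(K(h_□)G′_□h_□λ)(x)| ≤ O(M⁻¹)e^{−δ₀d(y,y′)}|λ|"* ((3.89)), *"G′ = S(I − R)⁻¹ = Σ_n SRⁿ"* ((3.90)); p. 410 Cor 3.8: *"This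
theorem follows simply from Corollary 3.6 holding for all G′_□, □ ∈ 𝒟, from the bound (3.89) and Lemma 2.1"*.

WHAT THIS FILE DOES (block currency of `D4WalkBlock`).  DATA: a domain skeleton `L : DomainTerms` whose coefficient
`L.op b u` IS the local inverse `G′_□(u)` of term `b = □` (print: `G′_{Ω(□)}`, a function of the configuration `u`), a real
partition `h : L.B → n → ℝ` with supports `Es b` (print: `h_□`, `supp h_□ ⊂ □̃`, `Σ_□ h_□² = 1`), the family `K′ : E → Matrix n n ℂ`
with `Δ′(u) = 1 + K′(u)`; the prior engine's `Hd h b` (= `diag h_□`), `Pj Es b` (= `1_{□̃}`), `Ptot`, `Rem` BY NAME.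
* §1 block-norm algebra: diagonal sandwiches (`|h| ≤ 1`) do not increase block norms and kill blocks off the support; a left
  factor with vanishing row blocks kills the product's row blocks; entrywise analyticity of products.
* §2 THE TWO FAMILIES (no new definition: ne5's `TwoRunPencilDomains.withOp` replaces the coefficient, keeps the skeleton):
  seed `withOp L (b,u) ↦ H_b·G′_b(u)·H_b`, step `withOp L (b,u) ↦ [H_b, K′(u)]·G′_b(u)·H_b` (print's `K(h_□)G′_□h_□`,
  `K(h_□) := h_□K′ − K′h_□`, the sign of `Rem`); at `σ ≡ 1` their kernels ARE `Ptot`, `Rem` (`kernel_seed_one ∕ _step_one`).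
* §3 (3.88) DISCHARGED: `resummation_388` — `(1 + K′(u))·S(1,u) = 1 − R(1,u)` from `P_b(1 + K′(u))P_b·G′_b(u) = P_b`,
  `P_bG′_b(u) = G′_b(u)`, `Σ_b h_b² = 1`, by `resummation_identity`; `glued_one_eq_inv`: `S(1,u)(1 − R(1,u))⁻¹ = (1 + K′(u))⁻¹`.
* §4 THE LETTERS DERIVED (Cor 3.8 as a lemma): from `‖G′_b(u)‖_{y,y′} ≤ C_L` and `‖[H_b,K′(u)]‖_{y,y′} ≤ λ_K` on the ball, the
  commutator's blocks inside `dom b × dom b`, `|h_b| ≤ 1`, `supp h_b ⊂ Es b` with cubes inside `dom b`, `#dom b ≤ n_C`, and the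
  skeleton's geometry: `isDomainLocalB_seed` (`λ_S = C_L`), `isDomainLocalB_step` (`λ_R = n_C·λ_K·C_L`) — the (3.89) letter
  of `D4WalkBlockOneScale` is now a CONSEQUENCE whose smallness is `λ_K`'s (print: `K(h_□) = O(M⁻¹)`).
* §5 THE END `blockWalkExpansion_parametrix`: Thm 3.10 at one scale in block currency FROM THM 3.7's INPUT LETTERS — the
  σ-decorated glued family is a `BlockWalkExpansion`, torus-free letters, Neumann margin `q = O(λ_K)` at fixed cube geometry.
WHAT IT IS NOT: the local inverses `G′_□(u)` of BAŁABAN's `Δ^{(k)}` with the (3.42) ∕ Cor 3.6 bounds uniformly in `k`, the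
torus and the history (`hLbd`, `hLan` are letters), the commutator bound (3.88)–(3.89) for HIS `h_□`, `Δ^{(k)}` (`hKbd`), the
multi-scale structure, k-uniformity ((v)), `TermDomination` — all remain; (D4) instance 0∕1; words UNCHANGED.
-/

noncomputable section

namespace Summit.QuantumFields.BalabanUV.Gaps.D4WalkBlockParametrix

open Metric Set Finset
open Literature.MathematicalPhysics.QuantumFieldTheory.Balaban1983to89
open Literature.MathematicalPhysics.QuantumFieldTheory.Balaban1983to89.B9SectDWalk (Through MajSumLe DomBy)
open Literature.MathematicalPhysics.QuantumFieldTheory.Balaban1983to89.B9Thm34Ext (toB6)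
open Literature.MathematicalPhysics.QuantumFieldTheory.Balaban1983to89.B9Thm37GlueTorus (torusGeom tdist1 tdist1_nonneg)
open Literature.MathematicalPhysics.QuantumFieldTheory.Balaban1983to89.TreeLengthTorus (TPt)
open Literature.MathematicalPhysics.QuantumFieldTheory.Balaban1983to89.B5TorusCover (UT)
open Literature.MathematicalPhysics.QuantumFieldTheory.Balaban1983to89.B11SectG (RowSum)
open Literature.MathematicalPhysics.QuantumFieldTheory.Balaban1983to89.B13JointWalkExpansion (JointWalkExpansion)
open Literature.MathematicalPhysics.QuantumFieldTheory.Balaban1983to89.B13DomainKernelWalks (DomainTerms)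
open Summit.QuantumFields.BalabanUV.Gaps.D4WalkBlock
  (rowMass blockNorm blockNorm_nonneg rowMass_le_blockNorm blockNorm_le_of_rowMass_le blockNorm_mul_le BlockWalkExpansion)
open Summit.QuantumFields.BalabanUV.Gaps.D4WalkBlockLocal (IsDomainLocalB)
open Summit.QuantumFields.BalabanUV.Gaps.D4WalkBlockOneScale (blockWalkExpansion_oneScale)
open Summit.QuantumFields.BalabanUV.T4Continuum.Spine.NE5.TwoRunPencilDomains (withOp)
open Summit.QuantumFields.BalabanUV.Beta.UnitLatticeWalkInversion (Hd Pj Ptot Rem resummation_identity)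

/-! ## §1. Block-norm algebra of diagonal sandwiches and supports -/

section Algebra

variable {ν : ℕ} {K : Fin ν → ℕ}
variable {p n q : Type} [Fintype p] [Fintype n] [Fintype q]
variable (cub : p → UT K) (cubn : n → UT K) (cubq : q → UT K)

omit [Fintype p] in
/-- Row masses of `T·diag a` with `‖a‖ ≤ 1` are below those of `T`. [folklore] -/
theorem rowMass_mul_diagonal_le [DecidableEq n] (T : Matrix p n ℂ) {a : n → ℂ} (ha : ∀ j, ‖a j‖ ≤ 1) (i : p)
    (y' : UT K) : rowMass cubn (T * Matrix.diagonal a) i y' ≤ rowMass cubn T i y' := by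
  unfold rowMass
  refine Finset.sum_le_sum fun j _ => ?_
  rw [Matrix.mul_diagonal, norm_mul]
  exact mul_le_of_le_one_right (norm_nonneg _) (ha j)

/-- Row masses of `diag a·T` with `‖a‖ ≤ 1` are below those of `T`. [folklore] -/
theorem rowMass_diagonal_mul_le [DecidableEq p] (T : Matrix p n ℂ) {a : p → ℂ} (ha : ∀ i, ‖a i‖ ≤ 1) (i : p)
    (y' : UT K) : rowMass cubn (Matrix.diagonal a * T) i y' ≤ rowMass cubn T i y' := by
  unfold rowMass
  refine Finset.sum_le_sum fun j _ => ?_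
  rw [Matrix.diagonal_mul, norm_mul]
  exact mul_le_of_le_one_left (norm_nonneg _) (ha i)

/-- **`‖T·diag a‖_{y,y′} ≤ ‖T‖_{y,y′}`** for `‖a‖ ≤ 1` (print: `h_□` on the right, `|h_□| ≤ 1`). [cite: Balaban1985BackgroundPropagators, (3.87) p.409] -/
theorem blockNorm_mul_diagonal_le [DecidableEq n] (T : Matrix p n ℂ) {a : n → ℂ} (ha : ∀ j, ‖a j‖ ≤ 1) (y y' : UT K) :
    blockNorm cub cubn (T * Matrix.diagonal a) y y' ≤ blockNorm cub cubn T y y' :=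
  blockNorm_le_of_rowMass_le cub cubn _ y y' (blockNorm_nonneg cub cubn T y y') fun i hi =>
    (rowMass_mul_diagonal_le cubn T ha i y').trans (hi ▸ rowMass_le_blockNorm cub cubn T i y')

/-- **`‖diag a·T‖_{y,y′} ≤ ‖T‖_{y,y′}`** for `‖a‖ ≤ 1` (print: `h_□` on the left). [cite: Balaban1985BackgroundPropagators, (3.87) p.409] -/
theorem blockNorm_diagonal_mul_le [DecidableEq p] (T : Matrix p n ℂ) {a : p → ℂ} (ha : ∀ i, ‖a i‖ ≤ 1) (y y' : UT K) :
    blockNorm cub cubn (Matrix.diagonal a * T) y y' ≤ blockNorm cub cubn T y y' :=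
  blockNorm_le_of_rowMass_le cub cubn _ y y' (blockNorm_nonneg cub cubn T y y') fun i hi =>
    (rowMass_diagonal_mul_le cubn T ha i y').trans (hi ▸ rowMass_le_blockNorm cub cubn T i y')

/-- A right diagonal factor vanishing on the column cube kills the block: `‖T·diag a‖_{y,y′} = 0` if `a = 0` on cube `y′`
(print: `supp h_□ ⊂ □̃`). [cite: Balaban1985BackgroundPropagators, (3.87) p.409] -/
theorem blockNorm_mul_diagonal_eq_zero [DecidableEq n] (T : Matrix p n ℂ) {a : n → ℂ} (y y' : UT K)
    (ha : ∀ j, cubn j = y' → a j = 0) : blockNorm cub cubn (T * Matrix.diagonal a) y y' = 0 := by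
  refine le_antisymm (blockNorm_le_of_rowMass_le cub cubn _ y y' le_rfl fun i _ => le_of_eq ?_)
    (blockNorm_nonneg _ _ _ _ _)
  unfold rowMass
  exact Finset.sum_eq_zero fun j hj => by rw [Matrix.mul_diagonal, ha j (Finset.mem_filter.1 hj).2, mul_zero, norm_zero]

/-- A left diagonal factor vanishing on the row cube kills the block. [cite: Balaban1985BackgroundPropagators, (3.87) p.409] -/
theorem blockNorm_diagonal_mul_eq_zero [DecidableEq p] (T : Matrix p n ℂ) {a : p → ℂ} (y y' : UT K)
    (ha : ∀ i, cub i = y → a i = 0) : blockNorm cub cubn (Matrix.diagonal a * T) y y' = 0 := by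
  refine le_antisymm (blockNorm_le_of_rowMass_le cub cubn _ y y' le_rfl fun i hi => le_of_eq ?_)
    (blockNorm_nonneg _ _ _ _ _)
  unfold rowMass
  exact Finset.sum_eq_zero fun j _ => by rw [Matrix.diagonal_mul, ha i hi, zero_mul, norm_zero]

/-- A left factor whose row-cube blocks all vanish kills the product's row-cube blocks (submultiplicativity over cubes).
[cite: Balaban1985BackgroundPropagators, (3.92)–(3.94) p.410] -/
theorem blockNorm_mul_eq_zero_of_left (S : Matrix p n ℂ) (T : Matrix n q ℂ) (y y' : UT K)
    (hS : ∀ y'', blockNorm cub cubn S y y'' = 0) : blockNorm cub cubq (S * T) y y' = 0 := by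
  refine le_antisymm ?_ (blockNorm_nonneg _ _ _ _ _)
  calc blockNorm cub cubq (S * T) y y' ≤ ∑ y'' : UT K, blockNorm cub cubn S y y'' * blockNorm cubn cubq T y'' y' :=
        blockNorm_mul_le cub cubn cubq S T y y'
    _ = 0 := Finset.sum_eq_zero fun y'' _ => by rw [hS y'', zero_mul]

end Algebra

section Analytic

variable {p n q : Type} [Fintype n]
variable {E : Type*} [NormedAddCommGroup E] [NormedSpace ℂ E]

omit [Fintype n] in
/-- Entries of a product of entrywise-holomorphic matrix families are holomorphic (finite sum of products).
[cite: Balaban1988RG2Cluster, p.15] -/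
theorem differentiableOn_mul_apply [Fintype n] {S : E → Matrix p n ℂ} {T : E → Matrix n q ℂ} {U : Set E}
    (hS : ∀ i k, DifferentiableOn ℂ (fun u => S u i k) U) (hT : ∀ k j, DifferentiableOn ℂ (fun u => T u k j) U)
    (i : p) (j : q) : DifferentiableOn ℂ (fun u => (S u * T u) i j) U := by
  simp only [Matrix.mul_apply]
  exact DifferentiableOn.fun_sum fun k _ => (hS i k).mul (hT k j)

end Analytic

/-! ## §2. The two families on a domain skeleton; at `σ ≡ 1` they are `Ptot` and `Rem` -/

section Families

variable {d N' : ℕ} {ν : ℕ} {K : Fin ν → ℕ} [∀ i, NeZero (K i)]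
variable {n : Type} [Fintype n] [DecidableEq n]
variable {E : Type*} [NormedAddCommGroup E] [NormedSpace ℂ E]
variable (L : DomainTerms d N' ν K n n E) (h : L.B → n → ℝ) (Es : L.B → Finset n) (K' : E → Matrix n n ℂ)

/-- **At `σ ≡ 1` the seed family's kernel IS the parametrix** `Ptot = Σ_□ H_□G′_□(u)H_□` of the prior engine.
[cite: Balaban1985BackgroundPropagators, (3.87) p.409] -/
theorem kernel_seed_one (u : E) :
    (withOp L fun b u => Hd h b * L.op b u * Hd h b).kernel (fun _ => (1 : ℂ)) u = Ptot h (fun b => L.op b u) := by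
  show (∑ b : L.B, (∏ _j ∈ L.J b, (1 : ℂ)) • (Hd h b * L.op b u * Hd h b)) = ∑ b, Hd h b * L.op b u * Hd h b
  exact Finset.sum_congr rfl fun b _ => by rw [Finset.prod_const_one, one_smul]

/-- **At `σ ≡ 1` the step family's kernel IS the remainder** `Rem = Σ_□ [H_□, K′(u)]G′_□(u)H_□` of the prior engine (print's
`R = Σ_□ K(h_□)G′_□h_□`, (3.88)). [cite: Balaban1985BackgroundPropagators, (3.88) p.409] -/
theorem kernel_step_one (u : E) :
    (withOp L fun b u => (Hd h b * K' u - K' u * Hd h b) * L.op b u * Hd h b).kernel (fun _ => (1 : ℂ)) u =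
      Rem h (K' u) (fun b => L.op b u) := by
  show (∑ b : L.B, (∏ _j ∈ L.J b, (1 : ℂ)) • ((Hd h b * K' u - K' u * Hd h b) * L.op b u * Hd h b)) =
    ∑ b, (Hd h b * K' u - K' u * Hd h b) * L.op b u * Hd h b
  exact Finset.sum_congr rfl fun b _ => by rw [Finset.prod_const_one, one_smul]

/-! ## §3. (3.88) DISCHARGED by the prior engine's resummation identity; the glued family is `Δ′⁻¹` at `σ ≡ 1` -/

/-- **(3.88) DISCHARGED**: `(1 + K′(u))·S(1,u) = 1 − R(1,u)` for the two families of §2, from `Σ_□ h_□² = 1`, `supp h_□ ⊂ □̃`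
and the LOCAL-INVERSE identities `P_□G′_□(u) = G′_□(u)`, `P_□(1 + K′(u))P_□·G′_□(u) = P_□` — by the prior programme's
`UnitLatticeWalkInversion.resummation_identity` (b2b-balaban-beta-d4-p3, 2026-08-20) BY NAME.
[cite: Balaban1985BackgroundPropagators, (3.88) p.409] -/
theorem resummation_388 (u : E) (hsum : ∀ y, ∑ b, h b y ^ 2 = 1) (hsupp : ∀ b y, y ∉ Es b → h b y = 0)
    (hPL : ∀ b, Pj Es b * L.op b u = L.op b u) (hinv : ∀ b, Pj Es b * (1 + K' u) * Pj Es b * L.op b u = Pj Es b) :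
    (1 + K' u) * (withOp L fun b u => Hd h b * L.op b u * Hd h b).kernel (fun _ => (1 : ℂ)) u =
      1 - (withOp L fun b u => (Hd h b * K' u - K' u * Hd h b) * L.op b u * Hd h b).kernel (fun _ => (1 : ℂ)) u := by
  rw [kernel_seed_one, kernel_step_one]
  exact resummation_identity (K' u) h Es (fun b => L.op b u) hsum hsupp hPL hinv

/-- **THE GLUED FAMILY IS `Δ′(u)⁻¹` AT `σ ≡ 1`**: `S(1,u)·(1 − R(1,u))⁻¹ = (1 + K′(u))⁻¹` once `1 − R(1,u)` is invertible
((3.88) + uniqueness of the two-sided inverse of a square matrix). [cite: Balaban1985BackgroundPropagators, (3.90) p.409] -/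
theorem glued_one_eq_inv (u : E) (hsum : ∀ y, ∑ b, h b y ^ 2 = 1) (hsupp : ∀ b y, y ∉ Es b → h b y = 0)
    (hPL : ∀ b, Pj Es b * L.op b u = L.op b u) (hinv : ∀ b, Pj Es b * (1 + K' u) * Pj Es b * L.op b u = Pj Es b)
    (hunit : IsUnit
      (1 - (withOp L fun b u => (Hd h b * K' u - K' u * Hd h b) * L.op b u * Hd h b).kernel (fun _ => (1 : ℂ)) u).det) :
    (withOp L fun b u => Hd h b * L.op b u * Hd h b).kernel (fun _ => (1 : ℂ)) u *
        ((1 : Matrix n n ℂ) + (-1 : ℂ) •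
          (withOp L fun b u => (Hd h b * K' u - K' u * Hd h b) * L.op b u * Hd h b).kernel (fun _ => (1 : ℂ)) u)⁻¹ =
      (1 + K' u)⁻¹ := by
  have h388 := resummation_388 L h Es K' u hsum hsupp hPL hinv
  set Sk := (withOp L fun b u => Hd h b * L.op b u * Hd h b).kernel (fun _ => (1 : ℂ)) u
  set Rk := (withOp L fun b u => (Hd h b * K' u - K' u * Hd h b) * L.op b u * Hd h b).kernel (fun _ => (1 : ℂ)) u
  have e : (1 : Matrix n n ℂ) + (-1 : ℂ) • Rk = 1 - Rk := by rw [neg_one_smul, sub_eq_add_neg]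
  have h1 : (1 + K' u) * (Sk * (1 - Rk)⁻¹) = 1 := by
    rw [← Matrix.mul_assoc, h388, Matrix.mul_nonsing_inv _ hunit]
  rw [e]
  exact (Matrix.inv_eq_right_inv h1).symm

end Families

/-! ## §4. Cor 3.8 as a lemma: the block letters of the two families DERIVED from primitive letters -/

section Letters

variable {d N' : ℕ} {ν : ℕ} {K : Fin ν → ℕ} [∀ i, NeZero (K i)]
variable {n : Type} [Fintype n] [DecidableEq n]
variable {E : Type*} [NormedAddCommGroup E] [NormedSpace ℂ E]
variable {L : DomainTerms d N' ν K n n E} {h : L.B → n → ℝ} {Es : L.B → Finset n} {K' : E → Matrix n n ℂ}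
variable {c : B13.Consts} {cubn : n → UT K} {X : Finset (UT K)} {R CL lamK r : ℝ} {mJ nD nC : ℕ}
variable {ρ₀ ε₀ κ₀ μ cμ : ℝ}

omit [Fintype n] [DecidableEq n] in
/-- The complex entries of a partition function with `|h| ≤ 1` have norm `≤ 1`. [folklore] -/
private theorem norm_h_le (habs : ∀ b y, |h b y| ≤ 1) (b : L.B) (y : n) : ‖((h b y : ℝ) : ℂ)‖ ≤ 1 := by
  rw [Complex.norm_real, Real.norm_eq_abs]; exact habs b y

omit [Fintype n] [DecidableEq n] in
/-- Off its support a partition function's complex entry vanishes. [folklore] -/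
private theorem h_eq_zero (hsupp : ∀ b y, y ∉ Es b → h b y = 0) (hE : ∀ b y, y ∈ Es b → cubn y ∈ L.dom b)
    (b : L.B) {y' : UT K} (hy' : y' ∉ L.dom b) (j : n) (hj : cubn j = y') : ((h b j : ℝ) : ℂ) = 0 := by
  have : j ∉ Es b := fun hj' => hy' (hj ▸ hE b j hj')
  rw [hsupp b j this, Complex.ofReal_zero]

/-- **THE SEED FAMILY `□ ↦ h_□G′_□(u)h_□` IS BLOCK-LOCAL WITH `λ_S = C_L`** (the (3.87) half of Cor 3.8): blocks inside the
cubes of `supp h_□ ⊂ dom □`, block bound the local inverse's `C_L` (diagonal factors `|h_□| ≤ 1` do not increase block norms),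
entries holomorphic in `u`; the skeleton's geometry letters pass through.
[cite: Balaban1985BackgroundPropagators, (3.87) p.409, Cor 3.8 (3.91)–(3.94) p.410] -/
theorem isDomainLocalB_seed
    (hanchor : ∀ b, L.anchor b ∈ L.dom b) (hdiam : ∀ b, ∀ z ∈ L.dom b, ∀ z' ∈ L.dom b, tdist1 K z z' ≤ r)
    (hJ : ∀ b, (L.J b).card ≤ mJ) (hX : ∀ b, (L.J b).Nonempty → (L.dom b ∩ X).Nonempty)
    (hmult : ∀ z : UT K, (Finset.univ.filter fun b => L.anchor b = z).card ≤ nD)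
    (hsupp : ∀ b y, y ∉ Es b → h b y = 0) (habs : ∀ b y, |h b y| ≤ 1) (hE : ∀ b y, y ∈ Es b → cubn y ∈ L.dom b)
    (hLan : ∀ b i j, DifferentiableOn ℂ (fun u => L.op b u i j) (ball (0 : E) R))
    (hLbd : ∀ b, ∀ u ∈ ball (0 : E) R, ∀ y y', blockNorm cubn cubn (L.op b u) y y' ≤ CL) :
    IsDomainLocalB (withOp L fun b u => Hd h b * L.op b u * Hd h b) c cubn cubn X R CL r mJ nD where
  hanchor := hanchor
  hsuppB b u y y' hne := by
    change blockNorm cubn cubn (Hd h b * L.op b u * Hd h b) y y' ≠ 0 at hne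
    refine ⟨?_, ?_⟩
    · by_contra hy
      apply hne
      rw [Matrix.mul_assoc]
      exact blockNorm_diagonal_mul_eq_zero cubn cubn (L.op b u * Hd h b) y y' (fun i hi => h_eq_zero hsupp hE b hy i hi)
    · by_contra hy'
      apply hne
      exact blockNorm_mul_diagonal_eq_zero cubn cubn (Hd h b * L.op b u) y y' (fun j hj => h_eq_zero hsupp hE b hy' j hj)
  han b i j := by
    change DifferentiableOn ℂ (fun u => (Hd h b * L.op b u * Hd h b) i j) (ball (0 : E) R)
    simp only [Hd, Matrix.mul_diagonal, Matrix.diagonal_mul]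
    exact ((differentiableOn_const _).mul (hLan b i j)).mul (differentiableOn_const _)
  hbdB b u hu y y' := by
    change blockNorm cubn cubn (Hd h b * L.op b u * Hd h b) y y' ≤ CL
    calc blockNorm cubn cubn (Hd h b * L.op b u * Hd h b) y y' ≤ blockNorm cubn cubn (Hd h b * L.op b u) y y' :=
          blockNorm_mul_diagonal_le cubn cubn _ (norm_h_le habs b) y y'
      _ ≤ blockNorm cubn cubn (L.op b u) y y' := blockNorm_diagonal_mul_le cubn cubn _ (norm_h_le habs b) y y'
      _ ≤ CL := hLbd b u hu y y'
  hdiam := hdiam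
  hJ := hJ
  hX := hX
  hmult := hmult

/-- **THE STEP FAMILY `□ ↦ K(h_□)(u)G′_□(u)h_□` IS BLOCK-LOCAL WITH `λ_R = n_C·λ_K·C_L`** (the (3.89) half of Cor 3.8, the
(3.89)-shape letter of `D4WalkBlockOneScale` DERIVED): with the commutator `K(h_□)(u) = h_□K′(u) − K′(u)h_□` bounded by `λ_K`
in block norm on the ball and having its blocks inside `dom □ × dom □` (print: localized near `supp ∇h_□ ⊂ □̃`), the local
inverse bounded by `C_L`, `#dom □ ≤ n_C` cubes: `‖K(h_□)G′_□h_□‖_{y,y′} ≤ Σ_{y″ ∈ dom □} λ_K·C_L ≤ n_Cλ_KC_L` — NO fibre,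
the smallness is `λ_K`'s (print: `O(M⁻¹)`). [cite: Balaban1985BackgroundPropagators, (3.88)–(3.89) p.409, Cor 3.8 (3.91)–(3.94) p.410] -/
theorem isDomainLocalB_step
    (hanchor : ∀ b, L.anchor b ∈ L.dom b) (hdiam : ∀ b, ∀ z ∈ L.dom b, ∀ z' ∈ L.dom b, tdist1 K z z' ≤ r)
    (hJ : ∀ b, (L.J b).card ≤ mJ) (hX : ∀ b, (L.J b).Nonempty → (L.dom b ∩ X).Nonempty)
    (hmult : ∀ z : UT K, (Finset.univ.filter fun b => L.anchor b = z).card ≤ nD)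
    (hsupp : ∀ b y, y ∉ Es b → h b y = 0) (habs : ∀ b y, |h b y| ≤ 1) (hE : ∀ b y, y ∈ Es b → cubn y ∈ L.dom b)
    (hLan : ∀ b i j, DifferentiableOn ℂ (fun u => L.op b u i j) (ball (0 : E) R))
    (hLbd : ∀ b, ∀ u ∈ ball (0 : E) R, ∀ y y', blockNorm cubn cubn (L.op b u) y y' ≤ CL) (hCL : 0 ≤ CL)
    (hKan : ∀ i j, DifferentiableOn ℂ (fun u => K' u i j) (ball (0 : E) R))
    (hKbd : ∀ b, ∀ u ∈ ball (0 : E) R, ∀ y y', blockNorm cubn cubn (Hd h b * K' u - K' u * Hd h b) y y' ≤ lamK)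
    (hlamK : 0 ≤ lamK)
    (hKsupp : ∀ b u y y', blockNorm cubn cubn (Hd h b * K' u - K' u * Hd h b) y y' ≠ 0 → y ∈ L.dom b ∧ y' ∈ L.dom b)
    (hcard : ∀ b, (L.dom b).card ≤ nC) :
    IsDomainLocalB (withOp L fun b u => (Hd h b * K' u - K' u * Hd h b) * L.op b u * Hd h b) c cubn cubn X R
      (nC * lamK * CL) r mJ nD where
  hanchor := hanchor
  hsuppB b u y y' hne := by
    change blockNorm cubn cubn ((Hd h b * K' u - K' u * Hd h b) * L.op b u * Hd h b) y y' ≠ 0 at hne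
    refine ⟨?_, ?_⟩
    · by_contra hy
      apply hne
      rw [Matrix.mul_assoc]
      refine blockNorm_mul_eq_zero_of_left cubn cubn cubn _ _ y y' (fun y'' => ?_)
      by_contra h0
      exact hy (hKsupp b u y y'' h0).1
    · by_contra hy'
      apply hne
      exact blockNorm_mul_diagonal_eq_zero cubn cubn ((Hd h b * K' u - K' u * Hd h b) * L.op b u) y y'
        (fun j hj => h_eq_zero hsupp hE b hy' j hj)
  han b i j := by
    change DifferentiableOn ℂ (fun u => ((Hd h b * K' u - K' u * Hd h b) * L.op b u * Hd h b) i j) (ball (0 : E) R)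
    have hcomm : ∀ i k, DifferentiableOn ℂ (fun u => (Hd h b * K' u - K' u * Hd h b) i k) (ball (0 : E) R) := by
      intro i k
      simp only [Hd, Matrix.sub_apply, Matrix.mul_diagonal, Matrix.diagonal_mul]
      exact ((differentiableOn_const _).mul (hKan i k)).sub ((hKan i k).mul (differentiableOn_const _))
    have h2 := differentiableOn_mul_apply (S := fun u => (Hd h b * K' u - K' u * Hd h b)) (T := fun u => L.op b u)
      hcomm (hLan b)
    simp only [Hd, Matrix.mul_diagonal]
    exact (h2 i j).mul (differentiableOn_const _)
  hbdB b u hu y y' := by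
    change blockNorm cubn cubn ((Hd h b * K' u - K' u * Hd h b) * L.op b u * Hd h b) y y' ≤ nC * lamK * CL
    classical
    have hstep1 : blockNorm cubn cubn ((Hd h b * K' u - K' u * Hd h b) * L.op b u * Hd h b) y y' ≤
        blockNorm cubn cubn ((Hd h b * K' u - K' u * Hd h b) * L.op b u) y y' :=
      blockNorm_mul_diagonal_le cubn cubn _ (norm_h_le habs b) y y'
    have hstep2 : blockNorm cubn cubn ((Hd h b * K' u - K' u * Hd h b) * L.op b u) y y' ≤
        ∑ y'' : UT K, blockNorm cubn cubn (Hd h b * K' u - K' u * Hd h b) y y'' * blockNorm cubn cubn (L.op b u) y'' y' :=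
      blockNorm_mul_le cubn cubn cubn _ _ y y'
    -- each summand is ≤ λ_K·C_L and vanishes unless y″ ∈ dom b
    have hterm : ∀ y'', blockNorm cubn cubn (Hd h b * K' u - K' u * Hd h b) y y'' * blockNorm cubn cubn (L.op b u) y'' y' ≤
        if y'' ∈ L.dom b then lamK * CL else 0 := by
      intro y''
      split_ifs with hy''
      · exact mul_le_mul (hKbd b u hu y y'') (hLbd b u hu y'' y') (blockNorm_nonneg _ _ _ _ _) hlamK
      · have h0 : blockNorm cubn cubn (Hd h b * K' u - K' u * Hd h b) y y'' = 0 := by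
          by_contra h0; exact hy'' (hKsupp b u y y'' h0).2
        rw [h0, zero_mul]
    have hstep3 : ∑ y'' : UT K, blockNorm cubn cubn (Hd h b * K' u - K' u * Hd h b) y y'' *
        blockNorm cubn cubn (L.op b u) y'' y' ≤ (L.dom b).card * (lamK * CL) := by
      calc ∑ y'' : UT K, blockNorm cubn cubn (Hd h b * K' u - K' u * Hd h b) y y'' * blockNorm cubn cubn (L.op b u) y'' y'
          ≤ ∑ y'' : UT K, (if y'' ∈ L.dom b then lamK * CL else 0) := Finset.sum_le_sum fun y'' _ => hterm y''
        _ = (L.dom b).card * (lamK * CL) := by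
            rw [Finset.sum_ite_mem, Finset.univ_inter, Finset.sum_const, nsmul_eq_mul]
    have hstep4 : ((L.dom b).card : ℝ) * (lamK * CL) ≤ nC * (lamK * CL) :=
      mul_le_mul_of_nonneg_right (by exact_mod_cast hcard b) (mul_nonneg hlamK hCL)
    calc _ ≤ _ := hstep1
      _ ≤ _ := hstep2
      _ ≤ _ := hstep3
      _ ≤ nC * (lamK * CL) := hstep4
      _ = nC * lamK * CL := by ring
  hdiam := hdiam
  hJ := hJ
  hX := hX
  hmult := hmult

/-! ## §5. THE END: Theorem 3.10 at one scale, block currency, FROM THEOREM 3.7's INPUT LETTERS -/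

/-- **THEOREM 3.10 AT ONE SCALE FROM THEOREM 3.7's INPUTS (block currency)**: a domain skeleton carrying local inverses
`G′_□(u)` (block bound `C_L`, holomorphic on the `R`-ball), a partition `{h_□}` (`|h_□| ≤ 1`, supports inside the domains),
commutators `K(h_□)(u)` (block bound `λ_K`, blocks inside the domains), `#dom □ ≤ n_C`, geometry `(r, m_J, n_D)`, the cube
row sum `(μ, c_μ)`, rates `0 ≤ μ`, `3μ ≤ ε₀`, `2μ ≤ κ₀`, `κ₀ + μ ≤ ρ₀ − ε₀`, and the Neumann MARGIN
`q = c_μ(c_μ·1·(1·K̄_R)c_μ)c_μ < 1` with `K̄_R = (n_Cλ_KC_L)e^{κ₁m_J}e^{2ρ₀r}e^{μr}n_Dc_μ` — `O(λ_K)` at fixed cube geometry,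
print's *"K(h_□) = O(M⁻¹) … M sufficiently large"* — ⟹ the σ-decorated glued family `S(σ,u)·(1 − R(σ,u))⁻¹` is a
`BlockWalkExpansion` at `(ρ₀ − 3μ, ε₀ − 3μ, κ₀ − 2μ)`, constant `c_μK̄_S(1·(1 − q)⁻¹)c_μ`, `K̄_S = C_Le^{κ₁m_J}e^{2ρ₀r}e^{μr}n_Dc_μ`,
EVERY LETTER TORUS-FREE; at `σ ≡ 1` it is `Δ′(u)⁻¹` (§3).  Composition BY NAME: §4 ×2 → `blockWalkExpansion_oneScale`.
[cite: Balaban1985BackgroundPropagators, Thm 3.7 (3.87)–(3.90) p.409, Cor 3.8 p.410, Thm 3.10 (3.107)–(3.108) p.416; Balaban1984PropagatorsII, (2.61) p.234; Balaban1988RG2Cluster, (1.11) p.5, p.13, p.15] -/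
theorem blockWalkExpansion_parametrix
    (hanchor : ∀ b, L.anchor b ∈ L.dom b) (hdiam : ∀ b, ∀ z ∈ L.dom b, ∀ z' ∈ L.dom b, tdist1 K z z' ≤ r)
    (hJ : ∀ b, (L.J b).card ≤ mJ) (hX : ∀ b, (L.J b).Nonempty → (L.dom b ∩ X).Nonempty)
    (hmult : ∀ z : UT K, (Finset.univ.filter fun b => L.anchor b = z).card ≤ nD)
    (hsupp : ∀ b y, y ∉ Es b → h b y = 0) (habs : ∀ b y, |h b y| ≤ 1) (hE : ∀ b y, y ∈ Es b → cubn y ∈ L.dom b)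
    (hLan : ∀ b i j, DifferentiableOn ℂ (fun u => L.op b u i j) (ball (0 : E) R))
    (hLbd : ∀ b, ∀ u ∈ ball (0 : E) R, ∀ y y', blockNorm cubn cubn (L.op b u) y y' ≤ CL) (hCL : 0 ≤ CL)
    (hKan : ∀ i j, DifferentiableOn ℂ (fun u => K' u i j) (ball (0 : E) R))
    (hKbd : ∀ b, ∀ u ∈ ball (0 : E) R, ∀ y y', blockNorm cubn cubn (Hd h b * K' u - K' u * Hd h b) y y' ≤ lamK)
    (hlamK : 0 ≤ lamK)
    (hKsupp : ∀ b u y y', blockNorm cubn cubn (Hd h b * K' u - K' u * Hd h b) y y' ≠ 0 → y ∈ L.dom b ∧ y' ∈ L.dom b)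
    (hcard : ∀ b, (L.dom b).card ≤ nC)
    (hκ₁ : 0 ≤ c.κ₁) (hμ : 0 ≤ μ) (hμε : 3 * μ ≤ ε₀) (hμκ : 2 * μ ≤ κ₀) (hwin : κ₀ + μ ≤ ρ₀ - ε₀) (hcμ : 0 ≤ cμ)
    (hrow : RowSum (toB6 (torusGeom K 0 0 0) 0 True) μ cμ)
    (hq : cμ * (cμ * 1 *
      (1 * (((nC * lamK * CL) * Real.exp (c.κ₁ * mJ) * Real.exp (2 * ρ₀ * r)) * Real.exp (μ * r) * (nD * cμ))) * cμ) *
        cμ < 1) :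
    ∃ (W : Type) (T : W → (TPt d N' → ℂ) → E → Matrix n n ℂ) (SX : Set W) (A : W → ℝ) (D : W → UT K → UT K → ℝ)
      (ρ' : ℝ), BlockWalkExpansion c cubn cubn
        (fun σ₀ u => (withOp L fun b u => Hd h b * L.op b u * Hd h b).kernel σ₀ u *
          ((1 : Matrix n n ℂ) + (-1 : ℂ) •
            (withOp L fun b u => (Hd h b * K' u - K' u * Hd h b) * L.op b u * Hd h b).kernel σ₀ u)⁻¹)
        X R (ε₀ - 3 * μ) (κ₀ - 2 * μ)
        (cμ * ((CL * Real.exp (c.κ₁ * mJ) * Real.exp (2 * ρ₀ * r)) * Real.exp (μ * r) * (nD * cμ)) *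
          (1 * (1 - cμ * (cμ * 1 *
            (1 * (((nC * lamK * CL) * Real.exp (c.κ₁ * mJ) * Real.exp (2 * ρ₀ * r)) * Real.exp (μ * r) * (nD * cμ))) *
              cμ) * cμ)⁻¹) * cμ)
        T SX A D ρ' ∧
      ∀ ω, DomBy (toB6 (torusGeom K 0 0 0) 0 True) (D ω) :=
  blockWalkExpansion_oneScale
    (isDomainLocalB_seed hanchor hdiam hJ hX hmult hsupp habs hE hLan hLbd)
    (isDomainLocalB_step hanchor hdiam hJ hX hmult hsupp habs hE hLan hLbd hCL hKan hKbd hlamK hKsupp hcard)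
    hκ₁ hCL (by positivity) hμ hμε hμκ hwin hcμ hrow hq

end Letters

end Summit.QuantumFields.BalabanUV.Gaps.D4WalkBlockParametrix

end
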